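import Mathlib.Analysis.SpecialFunctions.Log.Base
import Mathlib.Analysis.SpecialFunctions.Pow.Real
import Mathlib.Topology.Algebra.Order.Archimedean
import HarnessLib

/-!
# `ExistsScaleCovariantLimit` (item stmt-CriticalPhenomena-1981): the arithmetic of "two primes fix
the scale" — `{2^a 3^b : a, b ∈ ℤ}` is dense in `(0, ∞)`

Negative / structural knowledge for the crux (standing crux disprover, cycle 2, D-0016); THEOREM-ONLY,
pure Mathlib. `two_zpow_eq_three_zpow` (`2^q = 3^p ⇒ p = q = 0`), `dense_closure_log_two_log_three`
(the additive subgroup generated by `log 2, log 3` is dense: not cyclic), `exists_seq_two_three_tendsto`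
(every `c > 0` is a limit of `2^a 3^b`). Consumed by `Negative/DyadicTwoPrimes.lean`. [folklore]
-/

noncomputable section

namespace Summit.CriticalPhenomena.Ising3DConformalLimit.ExistsScaleCovariantLimitNegative.Dyadic

open Filter Set
open scoped Topology


/-- `2^q = 3^p` for integers forces `p = q = 0`. [folklore] -/
theorem two_zpow_eq_three_zpow {p q : ℤ} (h : (2:ℝ) ^ q = (3:ℝ) ^ p) : p = 0 ∧ q = 0 := by
  -- natural-number core: `2^a = 3^b → a = 0 ∧ b = 0`
  have core : ∀ a b : ℕ, (2:ℝ) ^ a = (3:ℝ) ^ b → a = 0 ∧ b = 0 := by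
    intro a b hab
    have hnat : 2 ^ a = 3 ^ b := by exact_mod_cast hab
    rcases Nat.eq_zero_or_pos a with ha | ha
    · subst ha
      simp at hnat
      exact ⟨rfl, (Nat.pow_eq_one.1 hnat.symm).resolve_left (by norm_num)⟩
    · exfalso
      have h2 : 2 ∣ 3 ^ b := by rw [← hnat]; exact dvd_pow_self 2 ha.ne'
      have : 2 ∣ 3 := Nat.Prime.dvd_of_dvd_pow Nat.prime_two h2
      omega
  rcases le_or_gt 0 q with hq | hq <;> rcases le_or_gt 0 p with hp | hp
  · obtain ⟨a, rfl⟩ := Int.eq_ofNat_of_zero_le hq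
    obtain ⟨b, rfl⟩ := Int.eq_ofNat_of_zero_le hp
    rw [zpow_natCast, zpow_natCast] at h
    obtain ⟨ha, hb⟩ := core a b h
    exact ⟨by simp [hb], by simp [ha]⟩
  · exfalso
    have h1 : (1:ℝ) ≤ (2:ℝ) ^ q := one_le_zpow₀ one_le_two hq
    have h2 : (3:ℝ) ^ p < 1 := zpow_lt_one_of_neg₀ (by norm_num) hp
    linarith
  · exfalso
    have h1 : (2:ℝ) ^ q < 1 := zpow_lt_one_of_neg₀ (by norm_num) hq
    have h2 : (1:ℝ) ≤ (3:ℝ) ^ p := one_le_zpow₀ (by norm_num) hp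
    linarith
  · have h' : (2:ℝ) ^ (-q) = (3:ℝ) ^ (-p) := by rw [zpow_neg, zpow_neg, h]
    obtain ⟨a, ha⟩ := Int.eq_ofNat_of_zero_le (by omega : 0 ≤ -q)
    obtain ⟨b, hb⟩ := Int.eq_ofNat_of_zero_le (by omega : 0 ≤ -p)
    rw [ha, hb, zpow_natCast, zpow_natCast] at h'
    obtain ⟨ha0, hb0⟩ := core a b h'
    omega

/-- **`{2^a 3^b}` is dense**: the additive subgroup of `ℝ` generated by `log 2` and `log 3` is dense
(it is not cyclic, by `two_zpow_eq_three_zpow`). [folklore] -/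
theorem dense_closure_log_two_log_three :
    Dense ((AddSubgroup.closure ({Real.log 2, Real.log 3} : Set ℝ) : AddSubgroup ℝ) : Set ℝ) := by
  set H := (AddSubgroup.closure ({Real.log 2, Real.log 3} : Set ℝ) : AddSubgroup ℝ) with hH
  rcases AddSubgroup.dense_or_cyclic H with hd | ⟨a, ha⟩
  · exact hd
  · exfalso
    have h2 : Real.log 2 ∈ H := AddSubgroup.subset_closure (by simp)
    have h3 : Real.log 3 ∈ H := AddSubgroup.subset_closure (by simp)
    rw [ha, AddSubgroup.mem_closure_singleton] at h2 h3
    obtain ⟨p, hp⟩ := h2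
    obtain ⟨q, hq⟩ := h3
    -- `q • log 2 = p • log 3`
    have hrel : (q:ℝ) * Real.log 2 = (p:ℝ) * Real.log 3 := by
      rw [← hp, ← hq]; simp only [zsmul_eq_mul]; ring
    have hexp : (2:ℝ) ^ q = (3:ℝ) ^ p := by
      have := congrArg Real.exp hrel
      rwa [← Real.log_zpow, ← Real.log_zpow, Real.exp_log (zpow_pos two_pos _),
        Real.exp_log (zpow_pos (by norm_num) _)] at this
    obtain ⟨hp0, hq0⟩ := two_zpow_eq_three_zpow hexp
    subst hq0
    have : Real.log 3 = 0 := by rw [← hq]; simp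
    have : (0:ℝ) < Real.log 3 := Real.log_pos (by norm_num)
    linarith

/-- Powers `2^a 3^b` approximate every positive real. [folklore] -/
theorem exists_seq_two_three_tendsto {c : ℝ} (hc : 0 < c) :
    ∃ u : ℕ → ℤ × ℤ, Tendsto (fun j => (2:ℝ) ^ (u j).1 * (3:ℝ) ^ (u j).2) atTop (𝓝 c) := by
  have hd := dense_closure_log_two_log_three
  -- `log c` is a limit of elements of the subgroup
  have hmem : Real.log c ∈ closure ((AddSubgroup.closure ({Real.log 2, Real.log 3} : Set ℝ) : AddSubgroup ℝ) : Set ℝ) :=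
    hd.closure_eq.symm ▸ Set.mem_univ _
  obtain ⟨v, hv, hvt⟩ := mem_closure_iff_seq_limit.1 hmem
  -- each element of the subgroup is `a log 2 + b log 3`
  have hform : ∀ j, ∃ ab : ℤ × ℤ, v j = ab.1 * Real.log 2 + ab.2 * Real.log 3 := by
    intro j
    have := hv j
    refine AddSubgroup.closure_induction (p := fun y _ => ∃ ab : ℤ × ℤ, y = ab.1 * Real.log 2 + ab.2 * Real.log 3)
      ?_ ?_ ?_ ?_ this
    · intro y hy
      simp only [Set.mem_insert_iff, Set.mem_singleton_iff] at hy
      rcases hy with rfl | rfl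
      · exact ⟨(1, 0), by simp⟩
      · exact ⟨(0, 1), by simp⟩
    · exact ⟨(0, 0), by simp⟩
    · rintro y z _ _ ⟨ab, rfl⟩ ⟨cd, rfl⟩
      exact ⟨(ab.1 + cd.1, ab.2 + cd.2), by push_cast; ring⟩
    · rintro y _ ⟨ab, rfl⟩
      exact ⟨(-ab.1, -ab.2), by push_cast; ring⟩
  choose u hu using hform
  refine ⟨u, ?_⟩
  have hexp : Tendsto (fun j => Real.exp (v j)) atTop (𝓝 (Real.exp (Real.log c))) :=
    (Real.continuous_exp.tendsto _).comp hvt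
  rw [Real.exp_log hc] at hexp
  refine hexp.congr fun j => ?_
  rw [hu j, Real.exp_add, show ((u j).1 : ℝ) * Real.log 2 = Real.log 2 * (u j).1 by ring,
    show ((u j).2 : ℝ) * Real.log 3 = Real.log 3 * (u j).2 by ring,
    Real.exp_mul, Real.exp_mul, Real.exp_log two_pos, Real.exp_log (by norm_num : (0:ℝ) < 3),
    Real.rpow_intCast, Real.rpow_intCast]


end Summit.CriticalPhenomena.Ising3DConformalLimit.ExistsScaleCovariantLimitNegative.Dyadic

end
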